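import Literature.Topology.FourManifolds.LeftHandSphereNeighborhoodsProofs
import Literature.Topology.FourManifolds.FramedSphereFamilyOfCharts
import Literature.Topology.FourManifolds.GradientLikeTurnAbout
import Literature.Topology.FourManifolds.HCobordismHandleCountProofs
import HarnessLib

/-!
# The two families of hand spheres in the middle level of a two-three handlebody

Topic `Literature/Topology/FourManifolds` (fact seat
`provefact-Literature.Topology.FourManifolds.corkDecomposition`; companion of
`CorkDecompositionMiddleLevel.lean` and `TwoThreeMiddleLevel.lean`).  Rung (B) of the cork DAG,
`Literature.Topology.FourManifolds.exists_dualSpheres_middleLevel_of_two_three`, asks for two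
framed families `S`, `P` of disjoint 2-spheres in the middle level `N` of a two-three
handlebody of a 5-dimensional h-cobordism — *"Each 2-handle has an ascending 3-ball which
meets `M_{1/2}` in a smoothly imbedded 2-sphere; call these `S_{0,i}`, `i = 1, …, n`.
Similarly each 3-handle descends to meet `M_{1/2}` in `S_{1,i}`, `i = 1, …, n`"* (Kirby 1996,
§2); *"We have two […] collections of embedded 2-spheres `{Sᵢ} ⊂ N`, `{Pᵢ} ⊂ N`"* (Matveyev
1996, p. 1) — which are moreover algebraically dual and along which surgery gives the two
ends.  This file constructs the two families (without the duality and the surgery clauses)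
from the tree's discharged form of Milnor's Def. 3.9 / §3 p. 21,
`Cobordism.Milnor1965_leftHandSpheres_productNeighborhood_holds`
(`LeftHandSphereNeighborhoodsProofs.lean`): the left-hand spheres of the index-3 critical
points, all on one level `v₃ > 1/2`, have disjoint product neighbourhoods `S² × ℝ² ↪ N` in the
level `1/2`; turning the triad about (`1 - g`, `-ξ`; Milnor, proof of Thm. 9.1) the same gives
the right-hand spheres of the index-2 points, all on one level `v₂ < 1/2`; the two families
are equinumerous by the Morse count of an h-cobordism
(`Cobordism.Milnor1965_ncard_criticalSetOfIndex_eq_of_isHCobordism_holds`, Milnor Thm. 7.4 with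
`H⁎(W, V) = 0`; Kirby: *"`i = 1, …, n`"* twice).

## Contents (all proved; no statement is introduced)

* `Literature.Topology.FourManifolds.Cobordism.IsMorseFunction.exists_framedSphereFamily_leftHandSphere` —
  for critical points `q i` of index `k + 1`, all on one level `v`, and a regular level
  `b < v` with no critical value in `[b, v)`, presented by `(V, ι)`: a framed sphere family
  `S : FramedSphereFamily (𝓡 n) V ι' k (n - k)` (`SphereFamilySurgery.lean`) whose `i`-th core
  sphere has image `ι⁻¹(S_L(q i))` (Milnor Def. 3.9, §3 p. 21; the bridge
  `FramedSphereFamily.ofChartsEuclidean` of `FramedSphereFamilyOfCharts.lean`).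
* `Literature.Topology.FourManifolds.Cobordism.IsMorseFunction.exists_framedSphereFamily_rightHandSphere` —
  the turned-about twin: right-hand spheres of critical points `p i` of index `n - k`, all on
  one level `v < b`, no critical value in `(v, b]`.
* `Literature.Topology.FourManifolds.Cobordism.IsHCobordism.exists_handSphereFamilies_of_two_three_oneLevel` —
  dimension `5`, a two-three Morse function in normal form (index-`2` points on the level
  `v₂ < 1/2`, index-`3` points on the level `v₃ > 1/2`, as produced by
  `Cobordism.IsMorseFunction.exists_two_three_oneLevel`, `TwoThreeMiddleLevel.lean`) with a
  gradient-like field `ξ` on an h-cobordism, the middle level presented by `(V, ι)`: a number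
  `k`, enumerations `q`, `p : Fin k → W` of the index-`3` and the index-`2` critical points,
  and framed families `S P : FramedSphereFamily (𝓡 4) V (Fin k) 2 2` with
  `ι(Sᵢ) = S_L(q i)`, `ι(Pᵢ) = S_R(p i)` in the level `1/2` — the data `k`, `S`, `P` of (B).

## References

* R. Kirby, *Akbulut's corks and h-cobordisms of smooth, simply connected 4-manifolds*, Turkish
  J. Math. 20 (1996) 85–93; arXiv:math/9712231, §2. [KirbyCorks1996]
* R. Matveyev, *A decomposition of smooth simply-connected h-cobordant 4-manifolds*,
  J. Differential Geom. 44 (1996) 571–582; arXiv:dg-ga/9505001, Proof of Theorem, p. 1.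
  [Matveyev1996]
* J. Milnor, *Lectures on the h-cobordism theorem*, Princeton (1965): Def. 3.9 (PDF p. 16),
  §3 p. 21 (PDF p. 21), Def. 4.5 (PDF p. 23), Thm. 7.4 (PDF p. 48), proof of Thm. 9.1
  (PDF p. 57). [MilnorHCobordism1965]
-/

open scoped Manifold ContDiff Topology
open Set Function

noncomputable section

namespace Literature.Topology.FourManifolds

universe u w

section General

variable {n : ℕ} {M N : Type u} [TopologicalSpace M] [T2Space M] [SecondCountableTopology M]
  [ChartedSpace (EuclideanSpace ℝ (Fin n)) M] [IsManifold (𝓡 n) ∞ M] [CompactSpace M]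
  [TopologicalSpace N] [T2Space N] [SecondCountableTopology N]
  [ChartedSpace (EuclideanSpace ℝ (Fin n)) N] [IsManifold (𝓡 n) ∞ N] [CompactSpace N]

/-- **The left-hand spheres of the critical points of one level, as a framed sphere family in
a lower level** (Milnor 1965, Def. 3.9, PDF p. 16, and §3, PDF p. 21: *"we obtain disjoint
characteristic embeddings `φᵢ : S^{λᵢ-1} × OD^{n-λᵢ} → V`"*).  Let `g` be a Morse function on
the cobordism `c` with smooth gradient-like `ξ`, `q : ι' → W` an injective family of critical
points of index `k + 1` (`k ≤ n`), all on the level `v`, and `0 < b < v` a level such that no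
critical value lies in `[b, v)`, presented by a closed `n`-manifold `V` embedded onto `g⁻¹(b)`
by `ι`.  Then there is a framed family of disjoint `k`-spheres with `(n - k)`-dimensional fibre
in `V` (`Literature.Topology.FourManifolds.FramedSphereFamily`) whose `i`-th core sphere is
carried by `ι` onto the left-hand sphere `S_L(q i)` in the level `b`: the disjoint product
neighbourhoods of `Cobordism.Milnor1965_leftHandSpheres_productNeighborhood_holds`, assembled by
`FramedSphereFamily.ofChartsEuclidean`.
[cite: MilnorHCobordism1965, Def. 3.9 (PDF p. 16), §3 (PDF p. 21), Def. 4.5 (PDF p. 23)] -/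
theorem Cobordism.IsMorseFunction.exists_framedSphereFamily_leftHandSphere
    {c : Cobordism n M N} {g : c.W → ℝ} (hg : c.IsMorseFunction g)
    (ξ : Cₛ^∞⟮𝓡∂ (n + 1); EuclideanSpace ℝ (Fin (n + 1)), (TangentSpace (𝓡∂ (n + 1)) : c.W → Type)⟯)
    (hξ : IsGradientLike (𝓡∂ (n + 1)) g ξ) {k : ℕ} (hk : k ≤ n)
    {ι' : Type w} {q : ι' → c.W} (hq : Injective q)
    (hqi : ∀ i, q i ∈ criticalSetOfIndex (𝓡∂ (n + 1)) g (k + 1)) {v : ℝ} (hqv : ∀ i, g (q i) = v)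
    {b : ℝ} (hb : 0 < b) (hbv : b < v)
    (hgap : ∀ z ∈ criticalSet (𝓡∂ (n + 1)) g, g z ∉ Ico b v)
    (V : Type u) [TopologicalSpace V] [T2Space V] [SecondCountableTopology V] [CompactSpace V]
    [ChartedSpace (EuclideanSpace ℝ (Fin n)) V] [IsManifold (𝓡 n) ∞ V] (ι : V → c.W)
    (hι : Manifold.IsSmoothEmbedding (𝓡 n) (𝓡∂ (n + 1)) ∞ ι) (hrange : range ι = g ⁻¹' {b}) :
    ∃ S : FramedSphereFamily (𝓡 n) V ι' k (n - k),
      ∀ i, ι '' range (S.sphere i) = leftHandSphere (𝓡∂ (n + 1)) g ξ (q i) b := by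
  obtain ⟨φ, hφ, hdisj⟩ :=
    Cobordism.Milnor1965_leftHandSpheres_productNeighborhood_holds hg ξ hξ hk (Q := range q)
      (by rintro _ ⟨i, rfl⟩; exact hqi i) (by rintro _ ⟨i, rfl⟩; exact hqv i) hb hbv hgap V ι
      hι hrange
  set φ' : ι' → OpenPartialHomeomorph
      ((Metric.sphere (0 : EuclideanSpace ℝ (Fin (k + 1))) 1) × EuclideanSpace ℝ (Fin (n - k))) V :=
    fun i => φ ⟨q i, mem_range_self i⟩ with hφ'
  have hdisj' : Pairwise fun i j => Disjoint (φ' i).target (φ' j).target := fun i j hij =>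
    hdisj fun h => hij (hq (congrArg Subtype.val h))
  refine ⟨FramedSphereFamily.ofChartsEuclidean (Nat.add_sub_cancel' hk) φ' (fun i => (hφ _).1)
    (fun i => (hφ _).2.1) (fun i => (hφ _).2.2.1) hdisj', fun i => ?_⟩
  rw [FramedSphereFamily.range_sphere_ofChartsEuclidean]
  exact (hφ _).2.2.2

/-- **The right-hand spheres of the critical points of one level, as a framed sphere family in
a higher level** — the turned-about twin of
`Cobordism.IsMorseFunction.exists_framedSphereFamily_leftHandSphere` (Milnor 1965, proof of
Thm. 9.1, PDF p. 57: for `(1 - g, -ξ)` on the reversed triad the critical points of index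
`n - k` become critical points of index `k + 1` and right-hand spheres become left-hand
spheres, `leftHandSphere_const_sub_neg`).  For an injective family `p : ι' → W` of critical
points of index `n - k` (`k ≤ n`), all on the level `v`, and a level `v < b < 1` with no
critical value in `(v, b]`, presented by `(V, ι)`: a framed family of disjoint `k`-spheres in
`V` whose `i`-th core sphere is carried by `ι` onto the right-hand sphere `S_R(p i)` in the
level `b`. [cite: MilnorHCobordism1965, Def. 3.9 (PDF p. 16), §3 (PDF p. 21), proof of Thm. 9.1 (PDF p. 57)] -/
theorem Cobordism.IsMorseFunction.exists_framedSphereFamily_rightHandSphere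
    {c : Cobordism n M N} {g : c.W → ℝ} (hg : c.IsMorseFunction g)
    (ξ : Cₛ^∞⟮𝓡∂ (n + 1); EuclideanSpace ℝ (Fin (n + 1)), (TangentSpace (𝓡∂ (n + 1)) : c.W → Type)⟯)
    (hξ : IsGradientLike (𝓡∂ (n + 1)) g ξ) {k : ℕ} (hk : k ≤ n)
    {ι' : Type w} {p : ι' → c.W} (hp : Injective p)
    (hpi : ∀ i, p i ∈ criticalSetOfIndex (𝓡∂ (n + 1)) g (n - k)) {v : ℝ} (hpv : ∀ i, g (p i) = v)
    {b : ℝ} (hvb : v < b) (hb : b < 1)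
    (hgap : ∀ z ∈ criticalSet (𝓡∂ (n + 1)) g, g z ∉ Ioc v b)
    (V : Type u) [TopologicalSpace V] [T2Space V] [SecondCountableTopology V] [CompactSpace V]
    [ChartedSpace (EuclideanSpace ℝ (Fin n)) V] [IsManifold (𝓡 n) ∞ V] (ι : V → c.W)
    (hι : Manifold.IsSmoothEmbedding (𝓡 n) (𝓡∂ (n + 1)) ∞ ι) (hrange : range ι = g ⁻¹' {b}) :
    ∃ R : FramedSphereFamily (𝓡 n) V ι' k (n - k),
      ∀ i, ι '' range (R.sphere i) = rightHandSphere (𝓡∂ (n + 1)) g ξ (p i) b := by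
  -- turn the triad about
  have hg' : c.symm.IsMorseFunction (fun z => 1 - g z) := hg.symm
  have hξ' : IsGradientLike (𝓡∂ (n + 1)) (fun z => 1 - g z) (⇑(-ξ)) := by
    rw [ContMDiffSection.coe_neg]
    exact hg.isGradientLike_const_sub_neg hξ 1
  have hcrit' : criticalSet (𝓡∂ (n + 1)) (fun z => 1 - g z) = criticalSet (𝓡∂ (n + 1)) g := by
    ext z
    exact isMCriticalPt_const_sub_iff 1 (hg.isMorse.contMDiff.mdifferentiableAt (by simp))
  have hidx' : criticalSetOfIndex (𝓡∂ (n + 1)) (fun z => 1 - g z) (k + 1) =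
      criticalSetOfIndex (𝓡∂ (n + 1)) g (n - k) := by
    rw [hg.criticalSetOfIndex_one_sub (by omega)]
    congr 1
    omega
  have hrange' : range ι = (fun z => 1 - g z) ⁻¹' {1 - b} := by
    rw [hrange]
    ext z
    simp only [mem_preimage, mem_singleton_iff, sub_right_inj]
  -- the hypotheses of the left-hand version for `(1 - g, -ξ)`, stated over `W`
  have hpi' : ∀ i, p i ∈ criticalSetOfIndex (𝓡∂ (n + 1)) (fun z => 1 - g z) (k + 1) := fun i => by
    rw [hidx']
    exact hpi i
  have hpv' : ∀ i, (fun z => 1 - g z) (p i) = 1 - v := fun i => by simp only [hpv i]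
  have hgap' : ∀ z ∈ criticalSet (𝓡∂ (n + 1)) (fun z => 1 - g z),
      (fun z => 1 - g z) z ∉ Ico (1 - b) (1 - v) := by
    intro z hz h
    rw [hcrit'] at hz
    exact hgap z hz ⟨by linarith [h.2], by linarith [h.1]⟩
  obtain ⟨S, hS⟩ := hg'.exists_framedSphereFamily_leftHandSphere (-ξ) hξ' hk hp hpi' hpv'
    (b := 1 - b) (by linarith) (by linarith) hgap' V ι hι hrange'
  refine ⟨S, fun i => (hS i).trans ?_⟩
  show leftHandSphere (𝓡∂ (n + 1)) (fun z => 1 - g z) (⇑(-ξ)) (p i) (1 - b) =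
    rightHandSphere (𝓡∂ (n + 1)) g (⇑ξ) (p i) b
  rw [ContMDiffSection.coe_neg]
  exact leftHandSphere_const_sub_neg 1

end General

/-! ### Dimension 5: the two families of 2-spheres of a two-three handlebody -/

section TwoThree

variable {X₁ X₂ : Type u} [TopologicalSpace X₁] [T2Space X₁] [SecondCountableTopology X₁]
  [ChartedSpace (EuclideanSpace ℝ (Fin 4)) X₁] [IsManifold (𝓡 4) ∞ X₁] [CompactSpace X₁]
  [TopologicalSpace X₂] [T2Space X₂] [SecondCountableTopology X₂]
  [ChartedSpace (EuclideanSpace ℝ (Fin 4)) X₂] [IsManifold (𝓡 4) ∞ X₂] [CompactSpace X₂]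

/-- **The two families of 2-spheres in the middle level of a two-three handlebody** (Kirby
1996, §2: *"Each 2-handle has an ascending 3-ball which meets `M_{1/2}` in a smoothly imbedded
2-sphere; call these `S_{0,i}`, `i = 1, …, n`.  Similarly each 3-handle descends to meet
`M_{1/2}` in `S_{1,i}`, `i = 1, …, n`.  […] Each 2-sphere has a trivial normal bundle"*;
Matveyev 1996, p. 1: *"two […] collections of embedded 2-spheres `{Sᵢ} ⊂ N`, `{Pᵢ} ⊂ N`"*).
Let `c` be an h-cobordism between closed 4-manifolds with a Morse function `g` in two-three
normal form — every critical point has index `2` and lies on the level `v₂ < 1/2`, or index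
`3` and lies on the level `v₃ > 1/2` (`Cobordism.IsMorseFunction.exists_two_three_oneLevel`)
—, a smooth gradient-like field `ξ`, and a presentation `(V, ι)` of the middle level
`g⁻¹(1/2)`.  Then for some `k` there are enumerations `q`, `p : Fin k → W` of the index-`3`
and of the index-`2` critical points (equinumerous by the Morse count of an h-cobordism,
`Cobordism.Milnor1965_ncard_criticalSetOfIndex_eq_of_isHCobordism_holds`) and framed families
`S`, `P` of `k` disjoint 2-spheres with 2-dimensional fibre in `V`
(`FramedSphereFamily (𝓡 4) V (Fin k) 2 2`, the format of rung (B)) such that `ι` carries the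
`i`-th core sphere of `S` onto the left-hand (descending) sphere `S_L(q i)` and the `i`-th core
sphere of `P` onto the right-hand (ascending) sphere `S_R(p i)` in the level `1/2`.
[cite: KirbyCorks1996, §2] [cite: Matveyev1996, Proof of Theorem, sentence 3 (arXiv p. 1)]
[cite: MilnorHCobordism1965, Def. 3.9 (PDF p. 16), §3 (PDF p. 21), Thm. 7.4 (PDF p. 48), proof of Thm. 9.1 (PDF p. 57)] -/
theorem Cobordism.IsHCobordism.exists_handSphereFamilies_of_two_three_oneLevel
    {c : Cobordism 4 X₁ X₂} (hc : c.IsHCobordism) {g : c.W → ℝ} (hg : c.IsMorseFunction g)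
    (ξ : Cₛ^∞⟮𝓡∂ (4 + 1); EuclideanSpace ℝ (Fin (4 + 1)), (TangentSpace (𝓡∂ (4 + 1)) : c.W → Type)⟯)
    (hξ : IsGradientLike (𝓡∂ (4 + 1)) g ξ) {v₂ v₃ : ℝ} (h₂ : v₂ < 2⁻¹) (h₃ : 2⁻¹ < v₃)
    (hval : ∀ z ∈ criticalSet (𝓡∂ (4 + 1)) g,
      morseIndex (𝓡∂ (4 + 1)) g z = 2 ∧ g z = v₂ ∨ morseIndex (𝓡∂ (4 + 1)) g z = 3 ∧ g z = v₃)
    (V : Type u) [TopologicalSpace V] [T2Space V] [SecondCountableTopology V] [CompactSpace V]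
    [ChartedSpace (EuclideanSpace ℝ (Fin 4)) V] [IsManifold (𝓡 4) ∞ V] (ι : V → c.W)
    (hι : Manifold.IsSmoothEmbedding (𝓡 4) (𝓡∂ (4 + 1)) ∞ ι) (hrange : range ι = g ⁻¹' {2⁻¹}) :
    ∃ (k : ℕ) (q p : Fin k → c.W) (S P : FramedSphereFamily (𝓡 4) V (Fin k) 2 2),
      Injective q ∧ range q = criticalSetOfIndex (𝓡∂ (4 + 1)) g 3 ∧
      Injective p ∧ range p = criticalSetOfIndex (𝓡∂ (4 + 1)) g 2 ∧
      (∀ i, ι '' range (S.sphere i) = leftHandSphere (𝓡∂ (4 + 1)) g ξ (q i) 2⁻¹) ∧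
      (∀ i, ι '' range (P.sphere i) = rightHandSphere (𝓡∂ (4 + 1)) g ξ (p i) 2⁻¹) := by
  classical
  -- the two critical sets are finite and equinumerous
  have hfin : (criticalSet (𝓡∂ (4 + 1)) g).Finite := hg.finite_criticalSet
  have hfin2 : (criticalSetOfIndex (𝓡∂ (4 + 1)) g 2).Finite :=
    hfin.subset fun z hz => mem_criticalSet.2 (mem_criticalSetOfIndex.1 hz).1
  have hfin3 : (criticalSetOfIndex (𝓡∂ (4 + 1)) g 3).Finite :=
    hfin.subset fun z hz => mem_criticalSet.2 (mem_criticalSetOfIndex.1 hz).1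
  have hind : ∀ z, IsMCriticalPt (𝓡∂ (4 + 1)) g z →
      morseIndex (𝓡∂ (4 + 1)) g z = 2 ∨ morseIndex (𝓡∂ (4 + 1)) g z = 2 + 1 := by
    intro z hz
    rcases hval z (mem_criticalSet.2 hz) with ⟨h, -⟩ | ⟨h, -⟩
    · exact Or.inl h
    · exact Or.inr h
  have hcount := Cobordism.Milnor1965_ncard_criticalSetOfIndex_eq_of_isHCobordism_holds hc hg hind
  haveI := hfin2.to_subtype
  haveI := hfin3.to_subtype
  obtain ⟨k, ⟨e₃⟩⟩ := finite_iff_exists_equiv_fin.1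
    (inferInstance : Finite ↥(criticalSetOfIndex (𝓡∂ (4 + 1)) g 3))
  obtain ⟨k₂, ⟨e₂⟩⟩ := finite_iff_exists_equiv_fin.1
    (inferInstance : Finite ↥(criticalSetOfIndex (𝓡∂ (4 + 1)) g 2))
  have hk₃ : (criticalSetOfIndex (𝓡∂ (4 + 1)) g 3).ncard = k := by
    rw [← Nat.card_coe_set_eq, Nat.card_eq_of_equiv_fin e₃]
  have hk₂ : (criticalSetOfIndex (𝓡∂ (4 + 1)) g 2).ncard = k₂ := by
    rw [← Nat.card_coe_set_eq, Nat.card_eq_of_equiv_fin e₂]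
  have hkk : k₂ = k := by rw [← hk₂, ← hk₃]; exact hcount
  subst hkk
  -- enumerations
  set q : Fin k₂ → c.W := fun i => (e₃.symm i : c.W) with hq
  set p : Fin k₂ → c.W := fun i => (e₂.symm i : c.W) with hp
  have hqinj : Injective q := Subtype.val_injective.comp e₃.symm.injective
  have hpinj : Injective p := Subtype.val_injective.comp e₂.symm.injective
  have hqrange : range q = criticalSetOfIndex (𝓡∂ (4 + 1)) g 3 := by
    ext z
    constructor
    · rintro ⟨i, rfl⟩; exact (e₃.symm i).2
    · intro hz; exact ⟨e₃ ⟨z, hz⟩, by simp [hq]⟩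
  have hprange : range p = criticalSetOfIndex (𝓡∂ (4 + 1)) g 2 := by
    ext z
    constructor
    · rintro ⟨i, rfl⟩; exact (e₂.symm i).2
    · intro hz; exact ⟨e₂ ⟨z, hz⟩, by simp [hp]⟩
  have hqi : ∀ i, q i ∈ criticalSetOfIndex (𝓡∂ (4 + 1)) g (2 + 1) := fun i => (e₃.symm i).2
  have hpi : ∀ i, p i ∈ criticalSetOfIndex (𝓡∂ (4 + 1)) g (4 - 2) := fun i => (e₂.symm i).2
  -- values on the two levels
  have hval3 : ∀ z ∈ criticalSetOfIndex (𝓡∂ (4 + 1)) g 3, g z = v₃ := by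
    intro z hz
    obtain ⟨hzc, hzi⟩ := mem_criticalSetOfIndex.1 hz
    rcases hval z (mem_criticalSet.2 hzc) with ⟨h, -⟩ | ⟨-, h⟩
    · omega
    · exact h
  have hval2 : ∀ z ∈ criticalSetOfIndex (𝓡∂ (4 + 1)) g 2, g z = v₂ := by
    intro z hz
    obtain ⟨hzc, hzi⟩ := mem_criticalSetOfIndex.1 hz
    rcases hval z (mem_criticalSet.2 hzc) with ⟨-, h⟩ | ⟨h, -⟩
    · exact h
    · omega
  have hqv : ∀ i, g (q i) = v₃ := fun i => hval3 _ (e₃.symm i).2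
  have hpv : ∀ i, g (p i) = v₂ := fun i => hval2 _ (e₂.symm i).2
  -- no critical values between the middle level and the two critical levels
  have hgap3 : ∀ z ∈ criticalSet (𝓡∂ (4 + 1)) g, g z ∉ Ico (2⁻¹ : ℝ) v₃ := by
    intro z hz h
    rcases hval z hz with ⟨-, e⟩ | ⟨-, e⟩
    · linarith [h.1]
    · linarith [h.2]
  have hgap2 : ∀ z ∈ criticalSet (𝓡∂ (4 + 1)) g, g z ∉ Ioc v₂ (2⁻¹ : ℝ) := by
    intro z hz h
    rcases hval z hz with ⟨-, e⟩ | ⟨-, e⟩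
    · linarith [h.1]
    · linarith [h.2]
  obtain ⟨S, hS⟩ := hg.exists_framedSphereFamily_leftHandSphere ξ hξ (k := 2) (by norm_num) hqinj
    hqi hqv (b := 2⁻¹) (by norm_num) h₃ hgap3 V ι hι hrange
  obtain ⟨P, hP⟩ := hg.exists_framedSphereFamily_rightHandSphere ξ hξ (k := 2) (by norm_num)
    hpinj hpi hpv (b := 2⁻¹) h₂ (by norm_num) hgap2 V ι hι hrange
  exact ⟨k₂, q, p, S, P, hqinj, hqrange, hpinj, hprange, hS, hP⟩

end TwoThree

end Literature.Topology.FourManifolds
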